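import Summits.Ventures.Crystal3D.Theorems.StickyWulffConstantCoaxialWallLawEndRowOuterShellSigDefs
import Summits.Ventures.Crystal3D.Theorems.StickyWulffConstantCoaxialWallLawEndRowOuterShell
import Summits.Ventures.Crystal3D.Theorems.StickyWulffConstantCoaxialWallLawOnSiteBridge
import HarnessLib

/-!
# The OUTER-SHELL REDUCTION on the SIGNATURE ROWS (census-free)

HONEST FRAMING. Venture `Summits/Ventures/Crystal3D` (cell `crystal3d-full`), helper `--supports` the crux
`CoaxialWallLaw` (stmt-Ventures-19481, `route-Ventures-StickyWulffConstant`), REGISTERED line `WallLedgerF`, open stub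
`stub_coaxialTwoSlabAdhesion`.  Rung credit only; F-C1 not moved.  cf-p1 DECISION (xlviii)(a) (2026-08-28T22:38Z): the
outer-shell reduction of `…EndRowOuterShell` restated on the signature-row statistic `localStatSig` of
`…EndRowOnSiteDefsA` (the row-by-signature on-site fact of PREREG-F-CERT v1.0), same mechanism.

* `localStatSig_le_localStatSigFlat` — `X ⊆ X'` agreeing inside `B̄(z, 2]`, `z ∈ X` a payer, the added balls off the far
  slots of the twin readings of `X` within `2` of `z`, signatures with unit slots ⇒
  `localStatSig X v Σ z ≤ localStatSigFlat X' v Σ z`; union form `localStatSig_le_localStatSigFlat_union`;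
* `localStatSig_le_localStatSigFlat_self` (`X' = X`) and **`endRowOnSiteA_of_endRowOnSiteFlatA`**: the flat on-site fact
  implies the plain one on the same universe (`EndRowOnSiteFlatA v s_F 𝒰 → EndRowOnSiteA v s_F 𝒰`);
* `norm_eq_one_of_mem_transSigs`, `norm_eq_one_of_mem_twinSigs` — the `8 + 12` row signature sets have unit slots;
* `endRowsA_of_onSiteFlatA_barlowWindowUniverse` — 19481-p2's bridge (`…OnSiteBridge`) fed with the flat fact.
WHAT THIS IS NOT: not the certificate, not the inner-tail bound, not the Barlow discharge of the far-slot hypothesis;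
F-C1 not moved.
-/

noncomputable section

namespace Summit.Ventures.Crystal3D.Theorems

open Summit.Ventures.Crystal3D Finset
open scoped InnerProductSpace

/-! ### Unit slots of the signature rows -/

/-- The direction of a signature has the norm of its slot. -/
theorem norm_sigDir_eq (σ : Bool × EuclideanSpace ℝ (Fin 3)) : ‖sigDir σ‖ = ‖σ.2‖ := by
  unfold sigDir
  exact LinearIsometryEquiv.norm_map _ _

/-- Translation row signatures have unit slots. -/
theorem norm_eq_one_of_mem_transSigs {ε : Bool} {n : EuclideanSpace ℝ (Fin 3)} {σ : Bool × EuclideanSpace ℝ (Fin 3)}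
    (h : σ ∈ transSigs ε n) : ‖σ.2‖ = 1 := by
  unfold transSigs planeHexagon at h
  rcases mem_union.1 h with h | h
  · obtain ⟨w, hw, rfl⟩ := mem_image.1 h
    exact norm_eq_one_of_mem_fccSlots (mem_filter.1 hw).1
  · obtain ⟨w, hw, rfl⟩ := mem_image.1 h
    exact norm_eq_one_of_mem_fccSlots (mem_filter.1 (mem_filter.1 hw).1).1

/-- Twin row signatures have unit slots. -/
theorem norm_eq_one_of_mem_twinSigs {ε : Bool} {h₀ : EuclideanSpace ℝ (Fin 3)} {σ : Bool × EuclideanSpace ℝ (Fin 3)}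
    (h : σ ∈ twinSigs ε h₀) : ‖σ.2‖ = 1 := by
  unfold twinSigs basalSector basalHexagon at h
  rcases mem_union.1 h with h | h
  · obtain ⟨w, hw, rfl⟩ := mem_image.1 h
    exact norm_eq_one_of_mem_fccSlots (mem_filter.1 (mem_filter.1 hw).1).1
  · obtain ⟨w, hw, rfl⟩ := mem_image.1 h
    rw [norm_neg]
    exact norm_eq_one_of_mem_fccSlots (mem_filter.1 (mem_filter.1 hw).1).1

/-! ### The reduction on signature rows -/

section Reduction

variable {X X' : Finset (EuclideanSpace ℝ (Fin 3))} {z : EuclideanSpace ℝ (Fin 3)} {v : WordVersion}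
  {sig : Finset (Bool × EuclideanSpace ℝ (Fin 3))}

/-- **Signature end pairs transfer**: a signature end pair `(b, q)` of `X` with `b` within `1` of `z` is a flat signature
end pair of `X'`. -/
theorem isEndPairSigFlat_of_isEndPairSig_outer (hsig : ∀ σ ∈ sig, ‖σ.2‖ = 1) (hsub : X ⊆ X')
    (hin : ∀ x ∈ X', dist z x ≤ 2 → x ∈ X)
    (hfar : ∀ q ∈ X, dist z q ≤ 2 → ∀ (G : EuclideanSpace ℝ (Fin 3) ≃ₗᵢ[ℝ] EuclideanSpace ℝ (Fin 3)) (m),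
      IsTwinReading X G m q → ∀ w ∈ fccSlots, 0 < ⟪G w, m⟫_ℝ → q + G w ∉ X')
    {b q : EuclideanSpace ℝ (Fin 3)} (hb : dist z b ≤ 1) (h : IsEndPairSig X v sig b q) :
    IsEndPairSigFlat X' v sig b q := by
  obtain ⟨hq, hbX, -, σ, hσ, hpred, hmove⟩ := h
  have hd : ‖sigDir σ‖ = 1 := by rw [norm_sigDir_eq]; exact hsig σ hσ
  have hbq : dist b q = 1 := dist_eq_one_of_isEndMove hd hmove
  have hzq : dist z q ≤ 2 := by
    calc dist z q ≤ dist z b + dist b q := dist_triangle _ _ _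
      _ ≤ 2 := by rw [hbq]; linarith
  exact ⟨hsub hq, hsub hbX, σ, hσ, hsub hpred,
    isEndMove_mono hsub hin hb hd (fun m htw => hfar q hq hzq _ m htw) hmove⟩

open scoped Classical in
/-- **Multiplicities**: `endMultSig X ≤ endMultSigFlat X'` at every ball within `1` of `z`. -/
theorem endMultSig_le_endMultSigFlat (hsig : ∀ σ ∈ sig, ‖σ.2‖ = 1) (hsub : X ⊆ X')
    (hin : ∀ x ∈ X', dist z x ≤ 2 → x ∈ X)
    (hfar : ∀ q ∈ X, dist z q ≤ 2 → ∀ (G : EuclideanSpace ℝ (Fin 3) ≃ₗᵢ[ℝ] EuclideanSpace ℝ (Fin 3)) (m),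
      IsTwinReading X G m q → ∀ w ∈ fccSlots, 0 < ⟪G w, m⟫_ℝ → q + G w ∉ X')
    {b : EuclideanSpace ℝ (Fin 3)} (hb : dist z b ≤ 1) :
    endMultSig X v sig b ≤ endMultSigFlat X' v sig b := by
  unfold endMultSig endMultSigFlat
  refine card_le_card fun q hq => ?_
  rw [mem_filter] at hq ⊢
  exact ⟨hsub hq.1, isEndPairSigFlat_of_isEndPairSig_outer hsig hsub hin hfar hb hq.2⟩

open scoped Classical in
/-- **THE OUTER-SHELL REDUCTION ON SIGNATURE ROWS.**  Let `X ⊆ X'` agree inside the closed ball `B̄(z, 2)` about a payer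
`z` of `X`, let the added balls avoid the far slots of every twin reading of `X` at a ball within `2` of `z`, and let the
signatures `Σ` have unit slots.  Then `localStatSig X v Σ z ≤ localStatSigFlat X' v Σ z`. -/
theorem localStatSig_le_localStatSigFlat (hsig : ∀ σ ∈ sig, ‖σ.2‖ = 1) (hsub : X ⊆ X')
    (hin : ∀ x ∈ X', dist z x ≤ 2 → x ∈ X) (hz : z ∈ X) (hzdeg : (X.filter fun q => dist z q = 1).card ≤ 11)
    (hfar : ∀ q ∈ X, dist z q ≤ 2 → ∀ (G : EuclideanSpace ℝ (Fin 3) ≃ₗᵢ[ℝ] EuclideanSpace ℝ (Fin 3)) (m),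
      IsTwinReading X G m q → ∀ w ∈ fccSlots, 0 < ⟪G w, m⟫_ℝ → q + G w ∉ X') :
    localStatSig X v sig z ≤ localStatSigFlat X' v sig z := by
  unfold localStatSig localStatSigFlat
  set B := X.filter (fun b => dist z b ≤ 1 ∧ 0 < endMultSig X v sig b) with hB
  set B' := X'.filter (fun b => dist z b ≤ 1 ∧ 0 < endMultSigFlat X' v sig b) with hB'
  have hBB : B ⊆ B' := by
    intro b hb
    rw [hB, mem_filter] at hb
    rw [hB', mem_filter]
    exact ⟨hsub hb.1, hb.2.1, lt_of_lt_of_le hb.2.2 (endMultSig_le_endMultSigFlat hsig hsub hin hfar hb.2.1)⟩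
  calc ∑ b ∈ B, (endMultSig X v sig b : ℝ) / pooledDef X b
      ≤ ∑ b ∈ B, (endMultSigFlat X' v sig b : ℝ) / pooledDefFlat X' b := by
        refine sum_le_sum fun b hb => ?_
        rw [hB, mem_filter] at hb
        obtain ⟨hbX, hbz, hpos⟩ := hb
        have htp : HasTwoPayers X b := by
          unfold endMultSig at hpos
          obtain ⟨q, hq⟩ := Finset.card_pos.1 hpos
          exact (mem_filter.1 hq).2.2.2.1
        refine div_le_div₀ (Nat.cast_nonneg _) ?_ ?_ ?_
        · exact_mod_cast endMultSig_le_endMultSigFlat hsig hsub hin hfar hbz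
        · linarith [one_le_pooledDefFlat hsub hin hz hzdeg hbz]
        · exact pooledDefFlat_le_pooledDef hsub hin hbz htp
    _ ≤ ∑ b ∈ B', (endMultSigFlat X' v sig b : ℝ) / pooledDefFlat X' b := by
        refine sum_le_sum_of_subset_of_nonneg hBB fun b hb _ => ?_
        rw [hB', mem_filter] at hb
        exact div_nonneg (Nat.cast_nonneg _) (by linarith [one_le_pooledDefFlat hsub hin hz hzdeg hb.2.1])

open scoped Classical in
/-- **Union form**: adding balls beyond distance `2` from the payer, off the far slots, only raises the statistic in its
flat form: `localStatSig X v Σ z ≤ localStatSigFlat (X ∪ A) v Σ z`. -/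
theorem localStatSig_le_localStatSigFlat_union (hsig : ∀ σ ∈ sig, ‖σ.2‖ = 1)
    (A : Finset (EuclideanSpace ℝ (Fin 3))) (hA : ∀ a ∈ A, 2 < dist z a) (hz : z ∈ X)
    (hzdeg : (X.filter fun q => dist z q = 1).card ≤ 11)
    (hfarA : ∀ q ∈ X, dist z q ≤ 2 → ∀ (G : EuclideanSpace ℝ (Fin 3) ≃ₗᵢ[ℝ] EuclideanSpace ℝ (Fin 3)) (m),
      IsTwinReading X G m q → ∀ w ∈ fccSlots, 0 < ⟪G w, m⟫_ℝ → q + G w ∉ A) :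
    localStatSig X v sig z ≤ localStatSigFlat (X ∪ A) v sig z := by
  refine localStatSig_le_localStatSigFlat hsig subset_union_left ?_ hz hzdeg ?_
  · intro x hx hxz
    rcases mem_union.1 hx with h | h
    · exact h
    · exact absurd hxz (not_le.2 (hA x h))
  · intro q hq hqz G m htw w hw hpos hmem
    rcases mem_union.1 hmem with h | h
    · exact htw.2.2.2 w hw hpos h
    · exact hfarA q hq hqz G m htw w hw hpos h

open scoped Classical in
/-- **Same configuration**: the signature statistic is at most its flat form (the far-slot hypothesis is automatic). -/
theorem localStatSig_le_localStatSigFlat_self (hsig : ∀ σ ∈ sig, ‖σ.2‖ = 1) (hz : z ∈ X)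
    (hzdeg : (X.filter fun q => dist z q = 1).card ≤ 11) :
    localStatSig X v sig z ≤ localStatSigFlat X v sig z := by
  have h := localStatSig_le_localStatSigFlat_union (v := v) hsig ∅ (fun a ha => absurd ha (Finset.notMem_empty a)) hz hzdeg
    (fun q _ _ G m _ w _ _ => Finset.notMem_empty _)
  rwa [union_empty] at h

end Reduction

/-! ### The flat on-site fact implies the plain one -/

open scoped Classical in
/-- On a universe of patterns containing their payer `0` with `deg 0 ≤ 11`, the FLAT on-site fact implies the on-site fact
of `…EndRowOnSiteDefsA` (same version, same constant). -/
theorem endRowOnSiteA_of_endRowOnSiteFlatA {v : WordVersion} {sF : ℝ} {𝒰 : Set (Finset (EuclideanSpace ℝ (Fin 3)))}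
    (h𝒰 : ∀ P ∈ 𝒰, (0 : EuclideanSpace ℝ (Fin 3)) ∈ P ∧
      (P.filter fun q => dist (0 : EuclideanSpace ℝ (Fin 3)) q = 1).card ≤ 11)
    (h : EndRowOnSiteFlatA v sF 𝒰) : EndRowOnSiteA v sF 𝒰 := by
  intro P hP
  obtain ⟨h0, hdeg⟩ := h𝒰 P hP
  obtain ⟨hT, hW⟩ := h P hP
  refine ⟨fun ε n hn => le_trans ?_ (hT ε n hn), fun ε h₀ hh => le_trans ?_ (hW ε h₀ hh)⟩
  · exact localStatSig_le_localStatSigFlat_self (fun σ hσ => norm_eq_one_of_mem_transSigs hσ) h0 hdeg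
  · exact localStatSig_le_localStatSigFlat_self (fun σ hσ => norm_eq_one_of_mem_twinSigs hσ) h0 hdeg

/-- The inner universe's patterns contain their payer, deficient: the flat fact on U-IN implies the plain fact on U-IN. -/
theorem endRowOnSiteA_inner_of_flat {v : WordVersion} {sF : ℝ} (h : EndRowOnSiteFlatA v sF barlowInnerUniverse) :
    EndRowOnSiteA v sF barlowInnerUniverse :=
  endRowOnSiteA_of_endRowOnSiteFlatA (fun _ hP => by obtain ⟨-, -, -, -, -, h0, hdeg⟩ := hP; exact ⟨h0, hdeg⟩) h

/-- The same on U-W(`vmax`). -/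
theorem endRowOnSiteA_window_of_flat {v : WordVersion} {sF : ℝ} {vmax : ℕ}
    (h : EndRowOnSiteFlatA v sF (barlowWindowUniverse vmax)) : EndRowOnSiteA v sF (barlowWindowUniverse vmax) :=
  endRowOnSiteA_of_endRowOnSiteFlatA
    (fun _ hP => by obtain ⟨-, -, -, -, -, -, h0, hdeg⟩ := hP; exact ⟨h0, hdeg⟩) h

/-- **Both typed (A) rows from the FLAT U-W on-site fact and the two tails**: 19481-p2's bridge
`endRowsA_of_onSiteA_barlowWindowUniverse` composed with `endRowOnSiteA_window_of_flat`. -/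
theorem endRowsA_of_onSiteFlatA_barlowWindowUniverse {v : WordVersion} {sF : ℝ} {vmax : ℕ}
    (hon : EndRowOnSiteFlatA v sF (barlowWindowUniverse vmax))
    (htailT : EndRowTransTailA v sF (barlowWindowUniverse vmax))
    (htailW : EndRowTwinTailA v sF (barlowWindowUniverse vmax)) : EndRowTwinHalfTurnA v sF ∧ EndRowTransA v sF :=
  endRowsA_of_onSiteA_barlowWindowUniverse (endRowOnSiteA_window_of_flat hon) htailT htailW

end Summit.Ventures.Crystal3D.Theorems

end
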